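import Summits.KontsevichZagierPeriods.KontsevichZagierPeriods.Theses.PeriodConductors

/-!
# `NoCutOverZ` (stmt-KontsevichZagierPeriods-8408, route PeriodConductors) — proof

Statement: for every number field `K` and every `c` in its ring of integers `𝓞 K` such that both
`c` and `1 - c` are units, one has `2 < |discr K|` ("over `Spec ℤ` there is nowhere to cut": a
solution of the unit equation `u + v = 1` forces `K ≠ ℚ`, hence a ramified prime).

Proof. If `1 < finrank ℚ K` the conclusion is Mathlib's Hermite–Minkowski bound
`NumberField.abs_discr_gt_two`, independently of `c`. Otherwise `finrank ℚ K = 1`, so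
`algebraMap ℚ K` is bijective (`Algebra.finrank_eq_one_iff_bijective_algebraMap`); restricting its
inverse to rings of integers and composing with `Rat.ringOfIntegersEquiv : 𝓞 ℚ ≃+* ℤ` gives a ring
homomorphism `𝓞 K →+* ℤ`, under which `c` and `1 - c` map to units `n` and `1 - n` of `ℤ`; but
`n, 1 - n ∈ {1, -1}` is impossible, so this case is vacuous.
-/

namespace Summit.KontsevichZagierPeriods.PeriodConductors

open NumberField

/-- In a number field of degree one over `ℚ` the unit equation has no solution: there is no
`c ∈ 𝓞 K` with both `c` and `1 - c` units (transport to `ℤ`, whose units are `±1`). [folklore] -/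
theorem no_unit_pair_of_finrank_eq_one (K : Type*) [Field K] [NumberField K]
    (h : Module.finrank ℚ K = 1) (c : 𝓞 K) (hc : IsUnit c) (hc' : IsUnit (1 - c)) : False := by
  -- `algebraMap ℚ K` is a bijection, hence a ring isomorphism `ℚ ≃+* K`.
  obtain ⟨e, -⟩ : ∃ e : ℚ ≃+* K, True :=
    ⟨RingEquiv.ofBijective (algebraMap ℚ K)
      (Algebra.finrank_eq_one_iff_bijective_algebraMap.mp h), trivial⟩
  -- The induced ring homomorphism `𝓞 K →+* ℤ`.
  obtain ⟨φ, -⟩ : ∃ φ : 𝓞 K →+* ℤ, True :=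
    ⟨Rat.ringOfIntegersEquiv.toRingHom.comp (RingOfIntegers.mapRingHom (e.symm : K →+* ℚ)),
      trivial⟩
  have h1 : IsUnit (φ c) := hc.map φ
  have h2 : IsUnit (1 - φ c) := by simpa using hc'.map φ
  rw [Int.isUnit_iff] at h1 h2
  omega

/-- **`NoCutOverZ`** (route PeriodConductors, stmt-KontsevichZagierPeriods-8408): if `c` and `1 - c`
are both units of the ring of integers of a number field `K`, then `2 < |discr K|`. In degree
`> 1` this is Hermite–Minkowski (`NumberField.abs_discr_gt_two`); in degree `1` no such `c` exists
(`no_unit_pair_of_finrank_eq_one`). [folklore] -/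
theorem noCutOverZ_proof :
    Summit.KontsevichZagierPeriods.KontsevichZagierPeriods.Theses.PeriodConductors.NoCutOverZ := by
  intro K _ _ c hc hc'
  rcases lt_or_ge 1 (Module.finrank ℚ K) with hK | hK
  · exact NumberField.abs_discr_gt_two hK
  · exact (no_unit_pair_of_finrank_eq_one K
      (le_antisymm hK (Nat.succ_le_of_lt Module.finrank_pos)) c hc hc').elim

end Summit.KontsevichZagierPeriods.PeriodConductors
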